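import Mathlib
import HarnessLib
import Literature.MathematicalPhysics.QuantumLattice.GaugeGroups
import Literature.LinearAlgebra.Matrix.UnitaryGroupMaximalTorus
import Literature.LinearAlgebra.Matrix.SpecialUnitaryGroupConjugacyClasses
import Summits.Ventures.LatticeQCDFlow.Exactness.FlowPushforward
import Summits.Ventures.LatticeQCDFlow.Exactness.CircleGroupJacobian
import Summits.Ventures.LatticeQCDFlow.Exactness.TorusCircleChart
import Summits.Ventures.LatticeQCDFlow.Exactness.SpecialTorusCircleChart
import Summits.Ventures.LatticeQCDFlow.Exactness.SU2TorusAlcoveJacobian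

/-!
# Haar on the diagonal tori in ANGLE coordinates: `Haar_{Δ(n)}` / `Haar_{SΔ(n)}` is the pushforward of normalised Lebesgue measure on the cube `(−π, π]^m`, and torus maps inherit cube Jacobians

HONEST FRAMING: exact (Metropolis-corrected) sampling algorithms for lattice gauge theory;
figures of merit are autocorrelation/cost numbers at stated couplings and volumes; no
continuum-physics claim.

Venture `LatticeQCDFlow` (cell pub-lqcd), topic `Exactness`; FANOUT row 10 (`eng-equiv`, engine
`latflow.equiv` `spectral.py`: `unitary_eig` returns eigen-PHASES `θ = angle(λ) ∈ (−π, π]`, and every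
subsequent step of the kernel is a map of the phases).  NEW WORK of the cell, the angle-coordinate
sequel of `TorusCircleChart.lean` / `SpecialTorusCircleChart.lean` (circle charts present Haar) and
`SU2TorusAlcoveJacobian.haarProbability_circle_eq_map_exp` (`Haar_{U(1)} = (2π)⁻¹ exp_* Leb|_(−π,π]`),
over Mathlib (`Measure.pi_eq`, `Measure.pi_pi`).  Nothing is cited as a fact; no number; no
definition.  The first of the three steps from the circle charts to the engine's `N ≥ 3` alcove
(cube → Weyl chambers → simplex cell); the other two are NOT here.

## What is typed (`κ` a finite index type; `λ = Leb|_(−π,π]`; `c = 2π`)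

* `map_exp_volume_Ioc` — `exp_* λ = (2π) · Haar_{U(1)}`;
* **`pi_haarProbability_circle_eq_map_cube`** — `⊗_κ Haar_{U(1)} = ((2π)^{#κ})⁻¹ · (θ ↦ (e^{iθ_k})_k)_* (⊗_κ λ)`:
  the product Haar measure of the torus `U(1)^κ` is the image of normalised Lebesgue measure on the
  cube of angles;
* **`haarProbability_diagonalTorus_eq_map_cube`**, **`haarProbability_specialDiagonalTorus_eq_map_cube`**
  — composed with the circle charts: `Haar_{Δ(n)}` / `Haar_{SΔ(n)}` are images of the normalised angle
  cubes `(−π,π]^n` / `(−π,π]^{n−1}`;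
* **`hasJacobian_specialDiagonalTorus_of_cubeChart`** (and the `Δ(n)` twin) — a torus map `F`
  intertwined Lebesgue-a.e. on the cube with a map `F'` of the angles having `HasJacobian (⊗ λ) F' J'`
  (e.g. any sequence of box coupling layers of `BoxCouplingFlowJacobian.lean` rescaled to `(−π, π]`,
  or circular splines), with `J ∘ E = J'` a.e., has `HasJacobian (Haar SΔ(n)) F J`.

NOT here: the decomposition of the angle cube into the `n!` Weyl chambers and the simplex cell map
(the remaining two steps for the engine's `N ≥ 3` kernel); any number.
-/

noncomputable section

namespace Summit.Ventures.LatticeQCDFlow.Exactness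

open MeasureTheory Matrix Topology Set Real
open Literature.LinearAlgebra.Matrix
open Literature.MathematicalPhysics.QuantumFieldTheory (haarProbability)
open scoped ENNReal

/-! ## The angle cube presents the product Haar measure of `U(1)^κ` -/

/-- `exp_* Leb|_(−π, π] = (2π) · Haar_{U(1)}`. -/
theorem map_exp_volume_Ioc :
    Measure.map (fun θ : ℝ => Circle.exp θ) (volume.restrict (Ioc (-π) π)) =
      ENNReal.ofReal (2 * π) • haarProbability Circle := by
  have h2π : ENNReal.ofReal (2 * π) ≠ 0 := by positivity
  rw [haarProbability_circle_eq_map_exp, smul_smul, ENNReal.mul_inv_cancel h2π ENNReal.ofReal_ne_top, one_smul]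

/-- The coordinatewise exponential `θ ↦ (e^{iθ_k})_k` is measurable. -/
theorem measurable_cubeExp {κ : Type*} [Fintype κ] :
    Measurable fun θ : κ → ℝ => fun k => Circle.exp (θ k) :=
  measurable_pi_lambda _ fun k => Circle.exp.continuous.measurable.comp (measurable_pi_apply k)

/-- **The angle cube presents the product Haar measure**:
`⊗_κ Haar_{U(1)} = ((2π)^{#κ})⁻¹ · (θ ↦ (e^{iθ_k})_k)_* (⊗_κ Leb|_(−π,π])`. -/
theorem pi_haarProbability_circle_eq_map_cube {κ : Type*} [Fintype κ] :
    (Measure.pi fun _ : κ => haarProbability Circle) =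
      ((ENNReal.ofReal (2 * π)) ^ Fintype.card κ)⁻¹ •
        Measure.map (fun θ : κ → ℝ => fun k => Circle.exp (θ k))
          (Measure.pi fun _ : κ => (volume.restrict (Ioc (-π) π) : Measure ℝ)) := by
  have h2π : ENNReal.ofReal (2 * π) ≠ 0 := by positivity
  have hpow0 : (ENNReal.ofReal (2 * π)) ^ Fintype.card κ ≠ 0 := pow_ne_zero _ h2π
  have hpowtop : (ENNReal.ofReal (2 * π)) ^ Fintype.card κ ≠ ∞ := ENNReal.pow_ne_top ENNReal.ofReal_ne_top
  symm
  refine (Measure.pi_eq fun s hs => ?_).symm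
  rw [Measure.smul_apply, Measure.map_apply measurable_cubeExp (MeasurableSet.univ_pi hs)]
  have hpre : (fun θ : κ → ℝ => fun k => Circle.exp (θ k)) ⁻¹' Set.pi univ s =
      Set.pi univ fun k => (fun θ : ℝ => Circle.exp θ) ⁻¹' s k := by
    ext θ
    simp only [Set.mem_preimage, Set.mem_univ_pi]
  rw [hpre, Measure.pi_pi]
  have hfac : ∀ k, (volume.restrict (Ioc (-π) π) : Measure ℝ) ((fun θ : ℝ => Circle.exp θ) ⁻¹' s k) =
      ENNReal.ofReal (2 * π) * haarProbability Circle (s k) := by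
    intro k
    rw [← Measure.map_apply Circle.exp.continuous.measurable (hs k), map_exp_volume_Ioc, Measure.smul_apply,
      smul_eq_mul]
  simp_rw [hfac]
  rw [Finset.prod_mul_distrib, Finset.prod_const, Finset.card_univ, smul_eq_mul, ← mul_assoc,
    ENNReal.inv_mul_cancel hpow0 hpowtop, one_mul]

variable {n : Type*} [Fintype n] [DecidableEq n]

/-! ## `U(n)`: Haar on `Δ(n)` from the angle cube -/

section Unitary

variable {chart : (n → Circle) → diagonalTorus n}
  (he : ∀ z i, (((chart z : diagonalTorus n) : Matrix.unitaryGroup n ℂ) : Matrix n n ℂ) i i = (z i : ℂ))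

include he

/-- **`Haar_{Δ(n)}` in angle coordinates**: `((2π)^n)⁻¹ · (θ ↦ diag(e^{iθ}))_* Leb|_{(−π,π]^n}`. -/
theorem haarProbability_diagonalTorus_eq_map_cube :
    haarProbability (diagonalTorus n) = ((ENNReal.ofReal (2 * π)) ^ Fintype.card n)⁻¹ •
      Measure.map (fun θ : n → ℝ => chart fun k => Circle.exp (θ k))
        (Measure.pi fun _ : n => (volume.restrict (Ioc (-π) π) : Measure ℝ)) := by
  rw [← map_circleChart_pi_haar_diagonalTorus he, pi_haarProbability_circle_eq_map_cube, Measure.map_smul,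
    Measure.map_map (circleChart_diagonalTorus_bijective_continuous he).2.2 measurable_cubeExp]
  rfl

/-- **Torus maps in angle coordinates (`U(n)`)**: a measurable `F : Δ(n) → Δ(n)` with measurable `J`,
intertwined a.e. on the angle cube with `F'` having `HasJacobian (⊗ Leb|_(−π,π]) F' J'`, and with
`J (diag e^{iθ}) = J' θ` a.e., has `HasJacobian (Haar Δ(n)) F J`. -/
theorem hasJacobian_diagonalTorus_of_cubeChart {F' : (n → ℝ) → (n → ℝ)} {J' : (n → ℝ) → ℝ≥0∞}
    (hF' : HasJacobian (Measure.pi fun _ : n => (volume.restrict (Ioc (-π) π) : Measure ℝ)) F' J')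
    {F : diagonalTorus n → diagonalTorus n} (hF : Measurable F) {J : diagonalTorus n → ℝ≥0∞} (hJ : Measurable J)
    (hcomm : ∀ᵐ θ ∂(Measure.pi fun _ : n => (volume.restrict (Ioc (-π) π) : Measure ℝ)),
      F (chart fun k => Circle.exp (θ k)) = chart fun k => Circle.exp (F' θ k))
    (hJ' : ∀ᵐ θ ∂(Measure.pi fun _ : n => (volume.restrict (Ioc (-π) π) : Measure ℝ)),
      J (chart fun k => Circle.exp (θ k)) = J' θ) :
    HasJacobian (haarProbability (diagonalTorus n)) F J := by
  rw [haarProbability_diagonalTorus_eq_map_cube he]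
  exact (hasJacobian_of_presentation_ae
    ((circleChart_diagonalTorus_bijective_continuous he).2.2.comp measurable_cubeExp) rfl hF' hF hJ
    hcomm hJ').smul_measure _

end Unitary

/-! ## `SU(n)`: Haar on `SΔ(n)` from the angle cube of the free phases -/

section SpecialUnitary

variable {i₀ : n} {schart : ({i : n // i ≠ i₀} → Circle) → specialDiagonalTorus n}
  (he : ∀ z (i : {i : n // i ≠ i₀}),
    (((schart z : specialDiagonalTorus n) : Matrix.specialUnitaryGroup n ℂ) : Matrix n n ℂ) i i = (z i : ℂ))

include he

/-- **`Haar_{SΔ(n)}` in angle coordinates**: `((2π)^{n−1})⁻¹ · (θ ↦ diag(e^{iθ̂}))_* Leb|_{(−π,π]^{n−1}}`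
(free phases `θ_i`, `i ≠ i₀`; the dependent phase by `det = 1`). -/
theorem haarProbability_specialDiagonalTorus_eq_map_cube :
    haarProbability (specialDiagonalTorus n) = ((ENNReal.ofReal (2 * π)) ^ Fintype.card {i : n // i ≠ i₀})⁻¹ •
      Measure.map (fun θ : {i : n // i ≠ i₀} → ℝ => schart fun k => Circle.exp (θ k))
        (Measure.pi fun _ : {i : n // i ≠ i₀} => (volume.restrict (Ioc (-π) π) : Measure ℝ)) := by
  rw [← map_circleChart_pi_haar_specialDiagonalTorus he, pi_haarProbability_circle_eq_map_cube,
    Measure.map_smul,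
    Measure.map_map (circleChart_specialDiagonalTorus_bijective_continuous he).2.2 measurable_cubeExp]
  rfl

/-- **Torus maps in angle coordinates (`SU(n)`)**: a measurable `F : SΔ(n) → SΔ(n)` with measurable
`J`, intertwined a.e. on the angle cube of the free phases with `F'` having
`HasJacobian (⊗ Leb|_(−π,π]) F' J'`, and with `J (diag e^{iθ̂}) = J' θ` a.e., has
`HasJacobian (Haar SΔ(n)) F J` — the hypothesis `hfJ` of
`hasJacobian_spectralKernel_specialUnitaryGroup_of_weyl` read on the angle cube. -/
theorem hasJacobian_specialDiagonalTorus_of_cubeChart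
    {F' : ({i : n // i ≠ i₀} → ℝ) → ({i : n // i ≠ i₀} → ℝ)} {J' : ({i : n // i ≠ i₀} → ℝ) → ℝ≥0∞}
    (hF' : HasJacobian (Measure.pi fun _ : {i : n // i ≠ i₀} => (volume.restrict (Ioc (-π) π) : Measure ℝ)) F' J')
    {F : specialDiagonalTorus n → specialDiagonalTorus n} (hF : Measurable F)
    {J : specialDiagonalTorus n → ℝ≥0∞} (hJ : Measurable J)
    (hcomm : ∀ᵐ θ ∂(Measure.pi fun _ : {i : n // i ≠ i₀} => (volume.restrict (Ioc (-π) π) : Measure ℝ)),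
      F (schart fun k => Circle.exp (θ k)) = schart fun k => Circle.exp (F' θ k))
    (hJ' : ∀ᵐ θ ∂(Measure.pi fun _ : {i : n // i ≠ i₀} => (volume.restrict (Ioc (-π) π) : Measure ℝ)),
      J (schart fun k => Circle.exp (θ k)) = J' θ) :
    HasJacobian (haarProbability (specialDiagonalTorus n)) F J := by
  rw [haarProbability_specialDiagonalTorus_eq_map_cube he]
  exact (hasJacobian_of_presentation_ae
    ((circleChart_specialDiagonalTorus_bijective_continuous he).2.2.comp measurable_cubeExp) rfl hF' hF hJ
    hcomm hJ').smul_measure _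

end SpecialUnitary

end Summit.Ventures.LatticeQCDFlow.Exactness
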